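import Mathlib
import HarnessLib
import Literature.Analysis.FluidPDE.PressureRepresentation
import Literature.Analysis.FluidPDE.PineauVicolPressureDecayClass
import Summits.NavierStokesRegularity.NavierStokesRegularity.Theorems.LocalTraceTubeDoorProfileRigidity
import Summits.NavierStokesRegularity.NavierStokesRegularity.Theorems.LocalPressureProfileDoorPressureCovariance

/-!
# The one-window door family — the ISOBARIC-WINDOW DOOR (corollary of door S14):
# a locally (space–time) Type-I singularity cannot have an asymptotically isobaric similarity window

Cell ns-regularity-ideate, seat p6 (route-directed support for nsreg-p1's door family; bears_on LADDER-NS N0; anchor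
`--supports stmt-NavierStokesRegularity-20018`, the profile-rigidity item of the family).  Sequel of
`…LocalTraceTubeDoorProfileRigidity` (door S14, harmonic-pressure profiles are trivial) using the SIMILARITY PRESSURE
zoom of the pressure door S17⁺ (`…Theses.LocalPressureProfileDoor.LocalPointZoomSimilarityPressure`, K1, a tree theorem).

* `traceSq_eq_neg_laplacian_pressurePotential` — for a divergence-free `C⁴` slice of the decay class,
  `tr(Dv ∘ Dv) = −ΔQ[v]` (`Q` = the Riesz pressure `pressurePotential`; tree `laplacian_pressurePotential_decay`,
  `pressureSource_eq_of_isDivFree`, `divergence_convect_self_eq`).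
* `isobaricWindowRigidity` — **PROFILE CRUX**: a profile of the pressure-door class (Type I in time `C`, space–time
  decay `D`, continuous, unit-viscosity Oseen-mild, divergence-free slices) whose Riesz pressure `Q[v(s)]` is CONSTANT
  on some nonempty open window of every slice `s < 0` is not backward-singular: on that window `ΔQ[v(s)] = 0`, i.e.
  `tr((Dv(s))²) = 0`, and door S14's window crux `traceSquareWindowRigidity` applies (slice analyticity spreads it,
  the canonical pressure gradient dies at large scales, viscous Burgers, maximum principle).
* `targetIso_of_zoom` — **THE DOOR modulo K1** (K1's text = `LocalPointZoomSimilarityPressure` VERBATIM as the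
  hypothesis): for a classical Leray–Hopf flow from rapidly decaying data with the LOCAL SPACE–TIME Type-I bound
  `‖u(t,x)‖ (‖x − x₀‖ + √(ν(T−t))) ≤ M` near `(x₀, T)`, if on ONE nonempty open similarity window `U` the
  scale-normalised Riesz pressure becomes ISOBARIC — `(T−t)·(Q[u(t)](x₀ + √(T−t)z) − Q[u(t)](x₀ + √(T−t)z')) → 0` as
  `t → T⁻` for all `z, z' ∈ U` — then `u` is backward bounded at `x₀`.  Proof: along the zoom times `tⱼ → T⁻` the
  K1 limits at two window points differ by the isobaric defect, so the profile's `Q[v(s)]` is constant on the window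
  `(√(−s)/√ν)·U` of every slice; `isobaricWindowRigidity` contradicts the singular apex.  (The unconditional door is
  `targetIso_of_zoom` applied to the tree theorem `…LocalPointZoomSimilarityPressure_proof`; that module lies in the
  theses cone of the pressure route, so the composition is left to a route file / closer.)

WHAT THIS IS NOT: not a claim about Navier–Stokes regularity (Clay A) — a local regularity CRITERION conditional on
local space–time Type I («Type-I blow-up keeps a pressure gradient on every similarity window»); establishment in the
cell's sense still requires the cross-family referee PASS + independent reproduction.
-/

noncomputable section

-- the summit and its single sub-problem share the name (CONVENTIONS §1), as in every Theorems file
set_option linter.dupNamespace false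

namespace Summit.NavierStokesRegularity.NavierStokesRegularity.Theorems.LocalTraceTubeDoorIsobaricWindow

open MeasureTheory Set Function Filter Topology TopologicalSpace Metric InnerProductSpace
open scoped RealInnerProductSpace InnerProductSpace Laplacian ContDiff
open Literature.Analysis Literature.Analysis.FluidPDE
open Summit.NavierStokesRegularity.NavierStokesRegularity.Theorems.LocalTraceTubeDoorProfileRigidity
open Summit.NavierStokesRegularity.NavierStokesRegularity.Theorems.LocalSineTubeDoorProfileAlignedWindowRigidityAncient
open Summit.NavierStokesRegularity.NavierStokesRegularity.Theorems.LocalPressureProfileDoorPressureCovariance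

variable {C D : ℝ} {v : ℝ → EuclideanSpace ℝ (Fin 3) → EuclideanSpace ℝ (Fin 3)}

/-- **`tr(Dw ∘ Dw) = −ΔQ[w]`** for a divergence-free `C⁴` field of the decay class `‖w(y)‖ ≤ K/(1 + ‖y‖)`. -/
theorem traceSq_eq_neg_laplacian_pressurePotential {w : EuclideanSpace ℝ (Fin 3) → EuclideanSpace ℝ (Fin 3)}
    (hw4 : ContDiff ℝ 4 w) {K : ℝ} (hdec : ∀ y, ‖w y‖ ≤ K / (1 + ‖y‖))
    (hdiv : VectorCalculus.IsDivFree w) (y : EuclideanSpace ℝ (Fin 3)) :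
    LinearMap.trace ℝ (EuclideanSpace ℝ (Fin 3))
        (((fderiv ℝ w y).comp (fderiv ℝ w y)) : EuclideanSpace ℝ (Fin 3) →ₗ[ℝ] EuclideanSpace ℝ (Fin 3)) =
      -(Δ (pressurePotential w)) y := by
  have hw2 : ContDiff ℝ 2 w := hw4.of_le (by norm_num)
  rw [PineauVicol2026.laplacian_pressurePotential_decay hw4 hdec y, neg_neg, pressureSource_eq_of_isDivFree hdiv,
    divergence_convect_self_eq hw2 hdiv y, traceCLM_apply]

/-- **PROFILE CRUX OF THE ISOBARIC-WINDOW DOOR**: a profile of the pressure-door class whose Riesz pressure `Q[v(s)]`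
is constant on some nonempty open window of every slice `s < 0` is not backward-singular — `ΔQ[v(s)] = 0` on the
window, so `tr((Dv(s))²) = 0` there (`traceSq_eq_neg_laplacian_pressurePotential`), and door S14's window crux
`traceSquareWindowRigidity` concludes. -/
theorem isobaricWindowRigidity (hrate : HasTypeITimeDecay C v) (hdecay : HasTypeIDecay D v)
    (hcont : ContinuousOn (uncurry v) (Iio (0 : ℝ) ×ˢ univ))
    (hmild : ∀ s t : ℝ, s < t → t < 0 → ∀ x,
      v t x = UnboundedOperators.heatExtension (v s) (t - s) x - oseenDuhamel 1 s v v t x)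
    (hdiv : ∀ t < 0, VectorCalculus.IsDivFree (v t))
    (hiso : ∀ s < 0, ∃ U : Set (EuclideanSpace ℝ (Fin 3)), IsOpen U ∧ U.Nonempty ∧
      ∃ c : ℝ, ∀ y ∈ U, pressurePotential (v s) y = c) :
    ¬ IsBackwardSingularPoint v 0 := by
  refine traceSquareWindowRigidity C v hrate hcont hmild hdiv fun s hs => ?_
  obtain ⟨U, hU, hne, c, hc⟩ := hiso s hs
  refine ⟨U, hU, hne, fun y hy => ?_⟩
  have hv4 : ContDiff ℝ 4 (v s) :=
    (analyticOnNhd_slice hcont (bdd_of_hasTypeITimeDecay hrate) hmild hs).contDiff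
  rw [traceSq_eq_neg_laplacian_pressurePotential hv4 (decay_slice_of_hasTypeIDecay hdecay hs) (hdiv s hs) y]
  -- `Q[v(s)]` agrees with the constant `c` near `y`, so its Laplacian vanishes there
  have hev : pressurePotential (v s) =ᶠ[𝓝 y] fun _ => c :=
    Filter.eventually_of_mem (hU.mem_nhds hy) fun z hz => hc z hz
  rw [(InnerProductSpace.laplacian_congr_nhds hev).self_of_nhds]
  simp [InnerProductSpace.laplacian_const]

/-- **THE ISOBARIC-WINDOW DOOR modulo the similarity-pressure zoom K1** (the hypothesis is the text of
`…Theses.LocalPressureProfileDoor.LocalPointZoomSimilarityPressure` VERBATIM, a tree theorem): under the leaf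
hypotheses of the pressure door (classical Leray–Hopf flow from rapidly decaying data, local SPACE–TIME Type-I bound
at `(x₀, T)`), if on ONE nonempty open similarity window `U` the scale-normalised Riesz pressure becomes isobaric,
`(T−t)·(Q[u(t)](x₀ + √(T−t)z) − Q[u(t)](x₀ + √(T−t)z')) → 0` as `t → T⁻` for all `z, z' ∈ U`, then `u` is backward
bounded at `x₀`. -/
theorem targetIso_of_zoom
    (hK1 : ∀ (ν T : ℝ), 0 < ν → 0 < T → ∀ (u : ℝ → EuclideanSpace ℝ (Fin 3) → EuclideanSpace ℝ (Fin 3)) (p : ℝ → EuclideanSpace ℝ (Fin 3) → ℝ), Literature.Analysis.FluidPDE.IsClassicalNSSolutionOn (Set.Ico 0 T) ν 0 u p → Literature.Analysis.FluidPDE.IsLerayHopfOn T ν 0 (u 0) u → Literature.Analysis.FluidPDE.HasRapidSpatialDecay (u 0) → ∀ (x₀ : EuclideanSpace ℝ (Fin 3)) (ρ M : ℝ), 0 < ρ → (∀ t ∈ Set.Ico 0 T, T - ρ ^ 2 < t → ∀ x ∈ Metric.ball x₀ ρ, ‖u t x‖ * (‖x - x₀‖ + Real.sqrt (ν * (T -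 t))) ≤ M) → ¬ Literature.Analysis.FluidPDE.IsBackwardBoundedAt u T x₀ → ∃ (C D : ℝ) (v : ℝ → EuclideanSpace ℝ (Fin 3) → EuclideanSpace ℝ (Fin 3)) (lam : ℕ → ℝ), (∀ j, 0 < lam j) ∧ Filter.Tendsto lam Filter.atTop (nhds 0) ∧ Literature.Analysis.FluidPDE.HasTypeITimeDecay C v ∧ Literature.Analysis.FluidPDE.HasTypeIDecay D v ∧ ContinuousOn (Function.uncurry v) (Set.Iio (0 : ℝ) ×ˢ Set.univ) ∧ (∀ s t : ℝ, s < t → t < 0 → ∀ x, v t x = Literature.Analysis.UnboundedOperators.heatExtension (v s) (t - s) x - Literature.Analysis.FluidPDE.oseenDuhamel 1 s v v t x) ∧ (∀ t < 0, Literature.Analysis.FluidPDE.VectorCalculus.IsDivFree (v t)) ∧ Literature.Analysis.FluidPDE.IsBackwardSingularPoint v 0 ∧ ∀ t < 0, ∀ y : EuclideanSpace ℝ (Fin 3), Filter.Tendsto (fun j : ℕ => ν⁻¹ * ((T - (T + lam j ^ 2 * t / ν)) * Literature.Analysis.FluidPDE.pressurePotential (u (T + lam j ^ 2 * t / ν))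 (x₀ + Real.sqrt (T - (T + lam j ^ 2 * t / ν)) • (Real.sqrt ν • y)))) Filter.atTop (nhds ((-t) * Literature.Analysis.FluidPDE.pressurePotential (v t) (Real.sqrt (-t) • y)))) :
    ∀ (ν T : ℝ), 0 < ν → 0 < T → ∀ (u : ℝ → EuclideanSpace ℝ (Fin 3) → EuclideanSpace ℝ (Fin 3))
      (p : ℝ → EuclideanSpace ℝ (Fin 3) → ℝ),
    Literature.Analysis.FluidPDE.IsClassicalNSSolutionOn (Set.Ico 0 T) ν 0 u p →
    Literature.Analysis.FluidPDE.IsLerayHopfOn T ν 0 (u 0) u →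
    Literature.Analysis.FluidPDE.HasRapidSpatialDecay (u 0) →
    ∀ (x₀ : EuclideanSpace ℝ (Fin 3)) (ρ M : ℝ), 0 < ρ →
    (∀ t ∈ Set.Ico 0 T, T - ρ ^ 2 < t → ∀ x ∈ Metric.ball x₀ ρ,
      ‖u t x‖ * (‖x - x₀‖ + Real.sqrt (ν * (T - t))) ≤ M) →
    ∀ (U : Set (EuclideanSpace ℝ (Fin 3))), IsOpen U → U.Nonempty →
    (∀ z ∈ U, ∀ z' ∈ U, Filter.Tendsto (fun t => (T - t) *
        (Literature.Analysis.FluidPDE.pressurePotential (u t) (x₀ + Real.sqrt (T - t) • z) -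
          Literature.Analysis.FluidPDE.pressurePotential (u t) (x₀ + Real.sqrt (T - t) • z')))
      (nhdsWithin T (Set.Iio T)) (nhds 0)) →
    Literature.Analysis.FluidPDE.IsBackwardBoundedAt u T x₀ := by
  intro ν T hν hT u p hsol hLH hdec x₀ ρ M hρ hM U hU hUne hiso
  by_contra hnot
  obtain ⟨C, D, v, lam, hlam, hlam0, hrate, hdecay, hcont, hmild, hdiv, hsing, hconv⟩ :=
    hK1 ν T hν hT u p hsol hLH hdec x₀ ρ M hρ hM hnot
  refine isobaricWindowRigidity hrate hdecay hcont hmild hdiv (fun s hs => ?_) hsing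
  have hns : 0 < -s := neg_pos.2 hs
  have hsν : 0 < Real.sqrt ν := Real.sqrt_pos.2 hν
  -- ## zoom times `tⱼ = T + λⱼ² s/ν → T⁻`
  obtain ⟨t, ht⟩ : ∃ t : ℕ → ℝ, ∀ j, t j = T + lam j ^ 2 * s / ν := ⟨_, fun j => rfl⟩
  have hTt : ∀ j, T - t j = lam j ^ 2 * (-s) / ν := fun j => by rw [ht j]; ring
  have hc : ∀ j, 0 < lam j ^ 2 * (-s) / ν := fun j => div_pos (mul_pos (pow_pos (hlam j) 2) hns) hν
  have hc0 : Tendsto (fun j => lam j ^ 2 * (-s) / ν) atTop (𝓝 0) := by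
    simpa using ((hlam0.pow 2).mul_const (-s)).div_const ν
  have htT : Tendsto t atTop (𝓝[<] T) := by
    refine tendsto_nhdsWithin_iff.2 ⟨?_, Eventually.of_forall fun j => ?_⟩
    · have h1 : Tendsto (fun j => T - lam j ^ 2 * (-s) / ν) atTop (𝓝 (T - 0)) :=
        tendsto_const_nhds.sub hc0
      rw [sub_zero] at h1
      refine h1.congr fun j => ?_
      rw [ht j]; ring
    · show t j < T
      have h1 := hc j
      rw [← hTt j] at h1
      linarith
  -- ## the window of the slice `s`: `σ • U`, `σ = √(−s)/√ν`
  set σ : ℝ := Real.sqrt (-s) / Real.sqrt ν with hσ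
  have hσpos : 0 < σ := div_pos (Real.sqrt_pos.2 hns) hsν
  have hyz : ∀ z : EuclideanSpace ℝ (Fin 3), Real.sqrt (-s) • ((Real.sqrt ν)⁻¹ • z) = σ • z := fun z => by
    rw [smul_smul, hσ, div_eq_mul_inv]
  -- ## two window points have the same limit pressure
  have key : ∀ z ∈ U, ∀ z' ∈ U, pressurePotential (v s) (σ • z) = pressurePotential (v s) (σ • z') := by
    intro z hz z' hz'
    have h1 := hconv s hs ((Real.sqrt ν)⁻¹ • z)
    have h2 := hconv s hs ((Real.sqrt ν)⁻¹ • z')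
    rw [smul_inv_smul₀ hsν.ne', hyz] at h1
    rw [smul_inv_smul₀ hsν.ne', hyz] at h2
    have hdiff := h1.sub h2
    -- the isobaric defect along the zoom times
    have hdoor : Tendsto (fun j => ν⁻¹ * ((T - t j) *
        (pressurePotential (u (t j)) (x₀ + Real.sqrt (T - t j) • z) -
          pressurePotential (u (t j)) (x₀ + Real.sqrt (T - t j) • z')))) atTop (𝓝 (ν⁻¹ * 0)) :=
      ((hiso z hz z' hz').comp htT).const_mul ν⁻¹
    rw [mul_zero] at hdoor
    have heq : (fun j => ν⁻¹ * ((T - (T + lam j ^ 2 * s / ν)) *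
          pressurePotential (u (T + lam j ^ 2 * s / ν)) (x₀ + Real.sqrt (T - (T + lam j ^ 2 * s / ν)) • z)) -
        ν⁻¹ * ((T - (T + lam j ^ 2 * s / ν)) *
          pressurePotential (u (T + lam j ^ 2 * s / ν)) (x₀ + Real.sqrt (T - (T + lam j ^ 2 * s / ν)) • z'))) =
        fun j => ν⁻¹ * ((T - t j) *
          (pressurePotential (u (t j)) (x₀ + Real.sqrt (T - t j) • z) -
            pressurePotential (u (t j)) (x₀ + Real.sqrt (T - t j) • z'))) := by
      funext j
      rw [ht j]
      ring
    rw [heq] at hdiff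
    have hlim := tendsto_nhds_unique hdiff hdoor
    have hmul : (-s) * (pressurePotential (v s) (σ • z) - pressurePotential (v s) (σ • z')) = 0 := by
      linarith
    rcases mul_eq_zero.1 hmul with h | h
    · exact absurd h hns.ne'
    · linarith
  -- ## the window `σ • U` of the slice `s`
  obtain ⟨u₀, hu₀⟩ := hUne
  refine ⟨(fun w => σ⁻¹ • w) ⁻¹' U, hU.preimage (continuous_const_smul σ⁻¹), ⟨σ • u₀, ?_⟩,
    pressurePotential (v s) (σ • u₀), fun w hw => ?_⟩
  · show σ⁻¹ • (σ • u₀) ∈ U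
    rwa [inv_smul_smul₀ hσpos.ne']
  · have hw' : σ⁻¹ • w ∈ U := hw
    have h := key (σ⁻¹ • w) hw' u₀ hu₀
    rwa [smul_inv_smul₀ hσpos.ne'] at h

end Summit.NavierStokesRegularity.NavierStokesRegularity.Theorems.LocalTraceTubeDoorIsobaricWindow

end
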